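import Mathlib.Probability.BrownianMotion.Basic
import Mathlib.Probability.Moments.SubGaussian
import Mathlib.Analysis.SpecificLimits.Normed
import Literature.Probability.Process.KolmogorovChentsovHolder
import HarnessLib

/-!
# Lévy's modulus of continuity of Brownian motion (upper bound)

For a real Brownian motion `B` (Mathlib `ProbabilityTheory.IsBrownianReal B P`) we prove the
upper half of **Lévy's modulus of continuity** (P. Lévy 1937) in the following dyadic-scale form
with a non-sharp constant: for every `N : ℕ`, almost surely,

* (`IsBrownianReal.ae_eventually_dist_le`) for all sufficiently large `n` and all
  `s, t ∈ [0, N]` with `|t - s| ≤ 2⁻ⁿ`, `|B t - B s| ≤ 48 √((n + 1) 2⁻ⁿ)`;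
* (`IsBrownianReal.ae_exists_dist_le`, `IsBrownianReal.ae_forall_exists_dist_le`) there is a
  (random) constant `C` with `|B t - B s| ≤ C √((n + 1) 2⁻ⁿ)` for *all* `n` and all
  `s, t ∈ [0, N]` with `|t - s| ≤ 2⁻ⁿ` (simultaneously for all `N`).

Since `√((n + 1) 2⁻ⁿ) ≍ √(h log(1/h))` for `2⁻ⁿ⁻¹ < h ≤ 2⁻ⁿ`, this is the statement that
`C √(h log(1/h))` is a modulus of continuity of almost every Brownian path on bounded intervals
(Lawler, *Conformally Invariant Processes in the Plane* (2005), Cor. 1.38, upper bound: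
`limsup_{δ→0+} osc(B, δ)/√(δ log(1/δ)) ≤ 6` w.p.1; Karatzas–Shreve (1991), Thm. 2.9.25, and
Revuz–Yor (1999), Thm. I.2.7, give Lévy's exact constant `√2`). Neither the sharp constant nor
the lower bound is proved here. In the scale `4^{-j}` this is exactly the hypothesis (4.28),
`|U_{t+s} - U_t| ≤ c √j 2^{-j}` for `s ≤ 2^{-2j}`, of Lawler's deterministic criterion
Lemma 4.33 for the existence of the Loewner trace, used in the proof of the Rohde–Schramm
theorem (Lawler (2005), Thm. 7.4; Rohde–Schramm (2005), Thm. 3.6/5.1) for the SLE driving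
function `U = √κ B`.

## The proof

The dyadic chaining proof (Karatzas–Shreve (1991), Problem 2.9.26 / proof of Thm. 2.2.8;
Le Gall (2016), Lemma 2.10), reusing the chaining apparatus of
`Literature.Probability.Process.KolmogorovChentsov(Holder)` (`Literature.Probability.Process.KolmogorovChentsov.dyad`,
`edist_le_tsum_of_increments_le`):

1. Gaussian increments are sub-Gaussian (`IsPreBrownianReal.hasSubgaussianMGF_sub`, from
   Mathlib's `mgf_gaussianReal`), whence the two-sided tail
   `P[|B s - B t| ≥ x] ≤ 2 exp(-x²/(2|s - t|))` (Mathlib's Chernoff bound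
   `HasSubgaussianMGF.measure_ge_le`).
2. With the level-`m` threshold `x_m = √(2m 2⁻ᵐ)`, the increment of
   `B` over a level-`m` dyadic interval exceeds `x_m` with probability `≤ 2 e⁻ᵐ`; summing over
   the `N 2ᵐ` intervals of `[0, N]` gives `2N (2/e)ᵐ`, which is summable, so by Borel–Cantelli
   almost surely all level-`m` increments on `[0, N]` are eventually `< x_m`
   (`IsPreBrownianReal.ae_eventually_abs_sub_dyad_lt`).
3. Chaining: `x_{n+1+i} ≤ √((n+1) 2⁻ⁿ) (i + 1) 2^{-i/2}`, so dyadic `s, t ≤ N` with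
   `|s - t| < 2⁻ⁿ`, `n ≥ n₀(ω)`, satisfy `|B s - B t| ≤ 2 S √((n+1) 2⁻ⁿ)` with
   `S = ∑ (i+1) 2^{-i/2} = (1 - 2^{-1/2})⁻² ≤ 16` (`Literature.Probability.Process.BrownianModulus.dist_le_of_increments`);
   continuity of the paths passes from dyadic to all points (at the cost of one scale, a factor
   `√2 ≤ 3/2`), giving the constant `48`.

The main theorems are deliberately placed in Mathlib's namespace
`ProbabilityTheory.IsBrownianReal` / `IsPreBrownianReal` (dot-notation extensions); everything
else lives in `Literature.BrownianModulus`.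

## References

* P. Lévy, *Théorie de l'addition des variables aléatoires*, Gauthier-Villars (1937), §52.
* G. F. Lawler, *Conformally Invariant Processes in the Plane*, AMS (2005), §1.13, Prop. 1.37,
  Cor. 1.38; Lemma 4.33 and Thm. 7.4 (use for SLE).
* I. Karatzas, S. Shreve, *Brownian Motion and Stochastic Calculus*, 2nd ed. (1991), Thm. 2.9.25,
  Problem 2.9.26.
* J.-F. Le Gall, *Brownian Motion, Martingales, and Stochastic Calculus* (2016), Lemma 2.10.
-/

noncomputable section

open MeasureTheory ProbabilityTheory Filter Set
open scoped ENNReal NNReal Topology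

namespace Literature.Probability.Process

namespace BrownianModulus

open KolmogorovChentsov

/-! ### Gaussian increments are sub-Gaussian; two-sided tails -/

/-- The centred Gaussian `N(0, v)` is sub-Gaussian with variance proxy `v` (its moment
generating function is `exp(v t²/2)`, Mathlib `mgf_id_gaussianReal`). [folklore] -/
theorem hasSubgaussianMGF_id_gaussianReal (v : ℝ≥0) :
    HasSubgaussianMGF id v (gaussianReal 0 v) where
  integrable_exp_mul t := by
    simpa using integrable_exp_mul_gaussianReal (μ := 0) (v := v) t
  mgf_le t := by
    rw [mgf_id_gaussianReal]
    simp

end BrownianModulus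

end Literature.Probability.Process

namespace ProbabilityTheory

open Literature.Probability.Process.KolmogorovChentsov Literature.Probability.Process.BrownianModulus

variable {Ω : Type*} {mΩ : MeasurableSpace Ω} {P : Measure Ω} {B : ℝ≥0 → Ω → ℝ}

/-- **Increments of a pre-Brownian motion are sub-Gaussian** with variance proxy `|s - t|`:
`B s - B t ∼ N(0, |s - t|)` (Mathlib `IsPreBrownianReal.hasLaw_sub`). (Dot-notation extension of
Mathlib's `ProbabilityTheory.IsPreBrownianReal`.) [folklore] -/
theorem IsPreBrownianReal.hasSubgaussianMGF_sub (hB : IsPreBrownianReal B P) (s t : ℝ≥0) :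
    HasSubgaussianMGF (B s - B t) (nndist s t) P := by
  have hlaw := hB.hasLaw_sub s t
  rw [← HasSubgaussianMGF.id_map_iff hlaw.aemeasurable, hlaw.map_eq]
  exact hasSubgaussianMGF_id_gaussianReal _

/-- **Two-sided Gaussian tail of the increments**: `P[|B s - B t| ≥ x] ≤ 2 exp(-x²/(2|s - t|))`
for `x ≥ 0` (Chernoff bound for the sub-Gaussian variables `±(B s - B t)`; for `s = t` the
right-hand side is `2` by the convention `a/0 = 0`). Lawler (2005), proof of Prop. 1.37
("`√(2π) P{X ≥ a} ≤ e^{-a²/2}`"). [cite: Lawler2005, Prop. 1.37 (proof)] -/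
theorem IsPreBrownianReal.measure_le_abs_sub_le (hB : IsPreBrownianReal B P) (s t : ℝ≥0) {x : ℝ}
    (hx : 0 ≤ x) :
    P {ω | x ≤ |B s ω - B t ω|} ≤ ENNReal.ofReal (2 * Real.exp (-x ^ 2 / (2 * dist s t))) := by
  haveI : IsProbabilityMeasure P := (hB.hasLaw_eval 0).isProbabilityMeasure
  have h := hB.hasSubgaussianMGF_sub s t
  have h1 : P.real {ω | x ≤ (B s - B t) ω} ≤ Real.exp (-x ^ 2 / (2 * nndist s t)) :=
    h.measure_ge_le hx
  have h2 : P.real {ω | x ≤ (-(B s - B t)) ω} ≤ Real.exp (-x ^ 2 / (2 * nndist s t)) :=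
    h.neg.measure_ge_le hx
  have hsub : {ω | x ≤ |B s ω - B t ω|} ⊆
      {ω | x ≤ (B s - B t) ω} ∪ {ω | x ≤ (-(B s - B t)) ω} := by
    intro ω hω
    simp only [mem_setOf_eq, mem_union, Pi.sub_apply, Pi.neg_apply] at hω ⊢
    exact le_abs.1 hω
  have hd : ((nndist s t : ℝ≥0) : ℝ) = dist s t := (dist_nndist s t).symm
  rw [hd] at h1 h2
  rw [← ofReal_measureReal]
  refine ENNReal.ofReal_le_ofReal ?_
  calc P.real {ω | x ≤ |B s ω - B t ω|}
      ≤ P.real ({ω | x ≤ (B s - B t) ω} ∪ {ω | x ≤ (-(B s - B t)) ω}) :=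
        measureReal_mono hsub
    _ ≤ P.real {ω | x ≤ (B s - B t) ω} + P.real {ω | x ≤ (-(B s - B t)) ω} :=
        measureReal_union_le _ _
    _ ≤ Real.exp (-x ^ 2 / (2 * dist s t)) + Real.exp (-x ^ 2 / (2 * dist s t)) :=
        add_le_add h1 h2
    _ = 2 * Real.exp (-x ^ 2 / (2 * dist s t)) := by ring

end ProbabilityTheory

namespace Literature.Probability.Process

namespace BrownianModulus

open KolmogorovChentsov

variable {Ω : Type*} {mΩ : MeasurableSpace Ω} {P : Measure Ω} {B : ℝ≥0 → Ω → ℝ}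

/-! ### Level thresholds and the Borel–Cantelli step -/

/-- `x_m² = 2 m 2⁻ᵐ` for the level threshold `x_m = √(2 m 2⁻ᵐ)`. [folklore] -/
theorem lvl_sq (m : ℕ) : Real.sqrt (2 * m / 2 ^ m) ^ 2 = 2 * m / 2 ^ m :=
  Real.sq_sqrt (by positivity)

/-- The increment over a level-`m` dyadic interval exceeds `x_m` with probability `≤ 2 e⁻ᵐ`.
[folklore] -/
theorem measure_lvl_le_abs_sub_dyad (hB : IsPreBrownianReal B P) (m k : ℕ) :
    P {ω | Real.sqrt (2 * m / 2 ^ m) ≤ |B (dyad m k) ω - B (dyad m (k + 1)) ω|} ≤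
      ENNReal.ofReal (2 * Real.exp (-1) ^ m) := by
  refine (hB.measure_le_abs_sub_le _ _ (Real.sqrt_nonneg _)).trans_eq ?_
  rw [← Real.exp_nat_mul, dist_dyad_succ, lvl_sq]
  congr 3
  have h2 : (2 : ℝ) ^ m ≠ 0 := pow_ne_zero _ two_ne_zero
  field_simp

/-- `2/e < 1`. [folklore] -/
theorem two_mul_exp_neg_one_lt_one : 2 * Real.exp (-1) < 1 := by
  have he : (2 : ℝ) < Real.exp 1 := by
    have := Real.add_one_lt_exp (one_ne_zero)
    norm_num at this
    linarith
  rw [Real.exp_neg, ← div_eq_mul_inv, div_lt_one (Real.exp_pos 1)]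
  exact he

/-- **Borel–Cantelli step**: for every `N`, almost surely, for all sufficiently fine levels `m`,
every increment of `B` over consecutive level-`m` dyadics of `[0, N]` is `< x_m = √(2 m 2⁻ᵐ)`
(the bad events have probability `≤ 2N (2/e)ᵐ`, a summable sequence). Lawler (2005), proof of
Prop. 1.37 (with chaining in place of the reflection principle); Karatzas–Shreve (1991),
proof of Thm. 2.9.25. [cite: Lawler2005, Prop. 1.37 (proof)] -/
theorem ae_eventually_abs_sub_dyad_lt (hB : IsPreBrownianReal B P) (N : ℕ) :
    ∀ᵐ ω ∂P, ∀ᶠ m in atTop, ∀ k, k + 1 ≤ N * 2 ^ m →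
      |B (dyad m k) ω - B (dyad m (k + 1)) ω| < Real.sqrt (2 * m / 2 ^ m) := by
  set A : ℕ → Set Ω := fun m ↦ ⋃ k ∈ Finset.range (N * 2 ^ m),
    {ω | Real.sqrt (2 * m / 2 ^ m) ≤ |B (dyad m k) ω - B (dyad m (k + 1)) ω|} with hA
  set r : ℝ≥0∞ := ENNReal.ofReal (2 * Real.exp (-1)) with hr
  have hbound : ∀ m, P (A m) ≤ ENNReal.ofReal (2 * N) * r ^ m := by
    intro m
    have hreal : ((N * 2 ^ m : ℕ) : ℝ) * (2 * Real.exp (-1) ^ m) =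
        2 * N * (2 * Real.exp (-1)) ^ m := by
      push_cast
      ring
    calc P (A m) ≤ ∑ k ∈ Finset.range (N * 2 ^ m),
          P {ω | Real.sqrt (2 * m / 2 ^ m) ≤ |B (dyad m k) ω - B (dyad m (k + 1)) ω|} :=
          measure_biUnion_finset_le _ _
      _ ≤ ∑ _k ∈ Finset.range (N * 2 ^ m), ENNReal.ofReal (2 * Real.exp (-1) ^ m) :=
          Finset.sum_le_sum fun k _ ↦ measure_lvl_le_abs_sub_dyad hB m k
      _ = ((N * 2 ^ m : ℕ) : ℝ≥0∞) * ENNReal.ofReal (2 * Real.exp (-1) ^ m) := by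
          rw [Finset.sum_const, Finset.card_range, nsmul_eq_mul]
      _ = ENNReal.ofReal ((N * 2 ^ m : ℕ) : ℝ) * ENNReal.ofReal (2 * Real.exp (-1) ^ m) := by
          rw [ENNReal.ofReal_natCast]
      _ = ENNReal.ofReal (((N * 2 ^ m : ℕ) : ℝ) * (2 * Real.exp (-1) ^ m)) :=
          (ENNReal.ofReal_mul (by positivity)).symm
      _ = ENNReal.ofReal (2 * N) * r ^ m := by
          rw [hreal, ENNReal.ofReal_mul (by positivity), hr, ENNReal.ofReal_pow (by positivity)]
  have hsum : ∑' m, P (A m) ≠ ∞ := by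
    have hρ : r < 1 := by
      rw [hr, ENNReal.ofReal_lt_one]
      exact two_mul_exp_neg_one_lt_one
    refine ne_top_of_le_ne_top ?_ (ENNReal.tsum_le_tsum hbound)
    rw [ENNReal.tsum_mul_left, ENNReal.tsum_geometric]
    exact ENNReal.mul_ne_top ENNReal.ofReal_ne_top
      (ENNReal.inv_ne_top.2 (tsub_pos_of_lt hρ).ne')
  filter_upwards [ae_eventually_notMem hsum] with ω hω
  filter_upwards [hω] with m hm k hk
  simp only [hA, Set.mem_iUnion, Finset.mem_range, Set.mem_setOf_eq, not_exists, not_le,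
    exists_prop, not_and] at hm
  exact hm k (by omega)

/-! ### The chaining constant -/

/-- `0 ≤ r` for the ratio `r = 2^{-1/2}` of the comparison series. [folklore] -/
theorem ratio_nonneg : 0 ≤ (Real.sqrt 2)⁻¹ := inv_nonneg.2 (Real.sqrt_nonneg 2)

/-- `r ≤ 3/4` (as `16/9 ≤ 2`). [folklore] -/
theorem ratio_le : (Real.sqrt 2)⁻¹ ≤ 3 / 4 := by
  rw [inv_le_comm₀ (Real.sqrt_pos.2 two_pos) (by norm_num)]
  rw [show ((3 : ℝ) / 4)⁻¹ = 4 / 3 by norm_num, Real.le_sqrt (by norm_num) (by norm_num)]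
  norm_num

/-- `r < 1`. [folklore] -/
theorem ratio_lt_one : (Real.sqrt 2)⁻¹ < 1 := ratio_le.trans_lt (by norm_num)

/-- `r² = 1/2`. [folklore] -/
theorem ratio_sq : (Real.sqrt 2)⁻¹ ^ 2 = 2⁻¹ := by
  rw [inv_pow, Real.sq_sqrt two_pos.le]

/-- `∑_{i ≥ 0} (i + 1) rⁱ = S := (1 - r)⁻²` for `r = 2^{-1/2}` (the chaining constant).
[folklore] -/
theorem hasSum_chainConst :
    HasSum (fun i : ℕ ↦ ((i : ℝ) + 1) * (Real.sqrt 2)⁻¹ ^ i)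
      ((1 - (Real.sqrt 2)⁻¹) ^ 2)⁻¹ := by
  have hr : ‖(Real.sqrt 2)⁻¹‖ < 1 := by
    rw [Real.norm_of_nonneg ratio_nonneg]
    exact ratio_lt_one
  have h1 := hasSum_coe_mul_geometric_of_norm_lt_one hr
  have h2 := hasSum_geometric_of_lt_one ratio_nonneg ratio_lt_one
  have h1r : (1 : ℝ) - (Real.sqrt 2)⁻¹ ≠ 0 := (sub_pos.2 ratio_lt_one).ne'
  have h3 : HasSum (fun i : ℕ ↦ (i : ℝ) * (Real.sqrt 2)⁻¹ ^ i + (Real.sqrt 2)⁻¹ ^ i)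
      ((Real.sqrt 2)⁻¹ / (1 - (Real.sqrt 2)⁻¹) ^ 2 + (1 - (Real.sqrt 2)⁻¹)⁻¹) :=
    h1.add h2
  have hf : (fun i : ℕ ↦ ((i : ℝ) + 1) * (Real.sqrt 2)⁻¹ ^ i) =
      fun i : ℕ ↦ (i : ℝ) * (Real.sqrt 2)⁻¹ ^ i + (Real.sqrt 2)⁻¹ ^ i := by
    funext i
    ring
  have hc : ((1 - (Real.sqrt 2)⁻¹) ^ 2)⁻¹ =
      (Real.sqrt 2)⁻¹ / (1 - (Real.sqrt 2)⁻¹) ^ 2 + (1 - (Real.sqrt 2)⁻¹)⁻¹ := by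
    field_simp
    ring
  rw [hf, hc]
  exact h3

/-- The comparison series is summable. [folklore] -/
theorem summable_ratio : Summable (fun i : ℕ ↦ ((i : ℝ) + 1) * (Real.sqrt 2)⁻¹ ^ i) :=
  hasSum_chainConst.summable

/-- `∑ (i + 1) rⁱ = S`. [folklore] -/
theorem tsum_ratio :
    ∑' i : ℕ, ((i : ℝ) + 1) * (Real.sqrt 2)⁻¹ ^ i = ((1 - (Real.sqrt 2)⁻¹) ^ 2)⁻¹ :=
  hasSum_chainConst.tsum_eq

/-- `0 < S`. [folklore] -/
theorem chainConst_pos : 0 < ((1 - (Real.sqrt 2)⁻¹) ^ 2)⁻¹ := by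
  rw [inv_pos]
  exact pow_pos (sub_pos.2 ratio_lt_one) 2

/-- `S ≤ 16` (as `1 - r ≥ 1/4`). [folklore] -/
theorem chainConst_le : ((1 - (Real.sqrt 2)⁻¹) ^ 2)⁻¹ ≤ 16 := by
  rw [inv_le_comm₀ (pow_pos (sub_pos.2 ratio_lt_one) 2) (by norm_num)]
  have h : (1 : ℝ) / 4 ≤ 1 - (Real.sqrt 2)⁻¹ := by linarith [ratio_le]
  calc ((16 : ℝ))⁻¹ = (1 / 4) ^ 2 := by norm_num
    _ ≤ (1 - (Real.sqrt 2)⁻¹) ^ 2 := pow_le_pow_left₀ (by norm_num) h 2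

/-- The level thresholds along the chain: `x_{n+1+i} ≤ √((n+1) 2⁻ⁿ) · (i + 1) rⁱ`. [folklore] -/
theorem lvl_add_le (n i : ℕ) :
    Real.sqrt (2 * ((n + 1 + i : ℕ) : ℝ) / 2 ^ (n + 1 + i)) ≤
      Real.sqrt ((n + 1) / 2 ^ n) * (((i : ℝ) + 1) * (Real.sqrt 2)⁻¹ ^ i) := by
  have hn : (0 : ℝ) ≤ n := Nat.cast_nonneg n
  have hi : (0 : ℝ) ≤ i := Nat.cast_nonneg i
  -- first factorisation: `2 (n+1+i) / 2^(n+1+i) ≤ ((n+1)/2^n) ((i+1)/2^i)`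
  have h1 : (2 : ℝ) * ((n + 1 + i : ℕ) : ℝ) / 2 ^ (n + 1 + i) ≤
      (n + 1) / 2 ^ n * ((i + 1) / 2 ^ i) := by
    have hle : ((n + 1 + i : ℕ) : ℝ) ≤ (n + 1) * (i + 1) := by
      push_cast
      nlinarith
    calc (2 : ℝ) * ((n + 1 + i : ℕ) : ℝ) / 2 ^ (n + 1 + i)
        = ((n + 1 + i : ℕ) : ℝ) / (2 ^ n * 2 ^ i) := by
          rw [pow_add, pow_succ]
          field_simp
      _ ≤ (n + 1) * (i + 1) / (2 ^ n * 2 ^ i) :=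
          div_le_div_of_nonneg_right hle (by positivity)
      _ = (n + 1) / 2 ^ n * ((i + 1) / 2 ^ i) := by rw [div_mul_div_comm]
  -- second: `√((i+1)/2^i) ≤ (i+1) rⁱ`
  have h2 : Real.sqrt ((i + 1) / 2 ^ i) ≤ ((i : ℝ) + 1) * (Real.sqrt 2)⁻¹ ^ i := by
    rw [Real.sqrt_le_left (mul_nonneg (by positivity) (pow_nonneg ratio_nonneg i))]
    have hsq : (((i : ℝ) + 1) * (Real.sqrt 2)⁻¹ ^ i) ^ 2 = ((i : ℝ) + 1) ^ 2 / 2 ^ i := by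
      rw [mul_pow, ← pow_mul, mul_comm i 2, pow_mul, ratio_sq, inv_pow, div_eq_mul_inv]
    rw [hsq]
    refine div_le_div_of_nonneg_right ?_ (by positivity)
    nlinarith
  calc Real.sqrt (2 * ((n + 1 + i : ℕ) : ℝ) / 2 ^ (n + 1 + i))
      ≤ Real.sqrt ((n + 1) / 2 ^ n * ((i + 1) / 2 ^ i)) := Real.sqrt_le_sqrt h1
    _ = Real.sqrt ((n + 1) / 2 ^ n) * Real.sqrt ((i + 1) / 2 ^ i) :=
        Real.sqrt_mul (by positivity) _
    _ ≤ Real.sqrt ((n + 1) / 2 ^ n) * (((i : ℝ) + 1) * (Real.sqrt 2)⁻¹ ^ i) :=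
        mul_le_mul_of_nonneg_left h2 (Real.sqrt_nonneg _)

/-- The tail sums of the thresholds: `∑_{i ≥ 0} x_{n+1+i} ≤ S √((n+1) 2⁻ⁿ)` (in `ℝ≥0∞`).
[folklore] -/
theorem tsum_lvl_le (n : ℕ) :
    ∑' i, ENNReal.ofReal (Real.sqrt (2 * ((n + 1 + i : ℕ) : ℝ) / 2 ^ (n + 1 + i))) ≤
      ENNReal.ofReal (((1 - (Real.sqrt 2)⁻¹) ^ 2)⁻¹ * Real.sqrt ((n + 1) / 2 ^ n)) := by
  have hg : ∀ i : ℕ,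
      0 ≤ Real.sqrt ((n + 1) / 2 ^ n) * (((i : ℝ) + 1) * (Real.sqrt 2)⁻¹ ^ i) :=
    fun i ↦ mul_nonneg (Real.sqrt_nonneg _) (mul_nonneg (by positivity) (pow_nonneg ratio_nonneg i))
  have hsum :
      Summable (fun i : ℕ ↦ Real.sqrt ((n + 1) / 2 ^ n) * (((i : ℝ) + 1) * (Real.sqrt 2)⁻¹ ^ i)) :=
    summable_ratio.mul_left _
  calc ∑' i, ENNReal.ofReal (Real.sqrt (2 * ((n + 1 + i : ℕ) : ℝ) / 2 ^ (n + 1 + i)))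
      ≤ ∑' i : ℕ, ENNReal.ofReal (Real.sqrt ((n + 1) / 2 ^ n) * (((i : ℝ) + 1) * (Real.sqrt 2)⁻¹ ^ i)) :=
        ENNReal.tsum_le_tsum fun i ↦ ENNReal.ofReal_le_ofReal (lvl_add_le n i)
    _ = ENNReal.ofReal (∑' i : ℕ, Real.sqrt ((n + 1) / 2 ^ n) * (((i : ℝ) + 1) * (Real.sqrt 2)⁻¹ ^ i)) :=
        (ENNReal.ofReal_tsum_of_nonneg hg hsum).symm
    _ = ENNReal.ofReal (((1 - (Real.sqrt 2)⁻¹) ^ 2)⁻¹ * Real.sqrt ((n + 1) / 2 ^ n)) := by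
        rw [tsum_mul_left, tsum_ratio, mul_comm]

/-! ### Chaining on the dyadics -/

/-- **Chaining**: if the increments of `f` over consecutive level-`m` dyadics of `[0, N]` are
`≤ x_m` for `m > n₀`, then dyadic `s, t ≤ N` with `|s - t| < 2⁻ⁿ`, `n ≥ n₀`, satisfy
`|f s - f t| ≤ 2 S √((n+1) 2⁻ⁿ)` (`KolmogorovChentsov.edist_le_tsum_of_increments_le` with
`δ m = x_m`, and `tsum_lvl_le`). Karatzas–Shreve (1991), Problem 2.9.26; Le Gall (2016),
Lemma 2.10. [cite: Legall2016, Lemma 2.10] -/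
theorem dist_le_of_increments {f : ℝ≥0 → ℝ} {N n₀ n : ℕ} (hn : n₀ ≤ n)
    (h : ∀ m, n₀ < m → ∀ k, k + 1 ≤ N * 2 ^ m → |f (dyad m k) - f (dyad m (k + 1))| ≤ Real.sqrt (2 * m / 2 ^ m))
    {s t : ℝ≥0} (hs : s ∈ dyadics) (ht : t ∈ dyadics) (hsN : s ≤ N) (htN : t ≤ N)
    (hd : dist s t < (2 ^ n)⁻¹) :
    dist (f s) (f t) ≤ 2 * ((1 - (Real.sqrt 2)⁻¹) ^ 2)⁻¹ * Real.sqrt ((n + 1) / 2 ^ n) := by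
  have h' : ∀ m, n₀ < m → ∀ k, k + 1 ≤ N * 2 ^ m →
      edist (f (dyad m k)) (f (dyad m (k + 1))) ≤ ENNReal.ofReal (Real.sqrt (2 * m / 2 ^ m)) := by
    intro m hm k hk
    rw [edist_dist, Real.dist_eq]
    exact ENNReal.ofReal_le_ofReal (h m hm k hk)
  have hchain := edist_le_tsum_of_increments_le (δ := fun m ↦ ENNReal.ofReal (Real.sqrt (2 * m / 2 ^ m))) hn h' hs ht
    hsN htN hd
  have hle : edist (f s) (f t) ≤ ENNReal.ofReal (2 * ((1 - (Real.sqrt 2)⁻¹) ^ 2)⁻¹ * Real.sqrt ((n + 1) / 2 ^ n)) := by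
    refine hchain.trans ?_
    rw [mul_assoc, ENNReal.ofReal_mul zero_le_two, ENNReal.ofReal_ofNat]
    gcongr
    exact tsum_lvl_le n
  rw [edist_dist] at hle
  exact (ENNReal.ofReal_le_ofReal_iff (mul_nonneg (mul_nonneg zero_le_two chainConst_pos.le)
    (Real.sqrt_nonneg _))).1 hle

/-- One scale down costs a factor `√2 ≤ 3/2`: `2 S √((n+1) 2^{-n}) ≤ 48 √((n+2) 2^{-(n+1)})`.
[folklore] -/
theorem two_mul_chainConst_mul_sqrt_le (n : ℕ) :
    2 * ((1 - (Real.sqrt 2)⁻¹) ^ 2)⁻¹ * Real.sqrt ((n + 1) / 2 ^ n) ≤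
      48 * Real.sqrt ((((n + 1 : ℕ) : ℝ) + 1) / 2 ^ (n + 1)) := by
  have hS := chainConst_le
  have hS0 := chainConst_pos.le
  have hsqrt : Real.sqrt ((n + 1) / 2 ^ n) ≤
      3 / 2 * Real.sqrt ((((n + 1 : ℕ) : ℝ) + 1) / 2 ^ (n + 1)) := by
    have h32 : (3 : ℝ) / 2 = Real.sqrt (9 / 4) := by
      rw [show (9 : ℝ) / 4 = (3 / 2) ^ 2 by norm_num, Real.sqrt_sq (by norm_num)]
    rw [h32, ← Real.sqrt_mul (by norm_num)]
    refine Real.sqrt_le_sqrt ?_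
    have hn0 : (0 : ℝ) ≤ n := Nat.cast_nonneg n
    have hX : (0 : ℝ) < 2 ^ n := by positivity
    have e1 : ((n : ℝ) + 1) / 2 ^ n = 2 * ((n : ℝ) + 1) / 2 ^ (n + 1) := by
      rw [pow_succ]
      field_simp
    rw [e1, mul_div_assoc']
    push_cast
    refine div_le_div_of_nonneg_right ?_ (by positivity)
    linarith
  calc 2 * ((1 - (Real.sqrt 2)⁻¹) ^ 2)⁻¹ * Real.sqrt ((n + 1) / 2 ^ n)
      ≤ 2 * 16 * (3 / 2 * Real.sqrt ((((n + 1 : ℕ) : ℝ) + 1) / 2 ^ (n + 1))) := by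
        gcongr
    _ = 48 * Real.sqrt ((((n + 1 : ℕ) : ℝ) + 1) / 2 ^ (n + 1)) := by ring

end BrownianModulus

end Literature.Probability.Process

namespace ProbabilityTheory

open Literature.Probability.Process.KolmogorovChentsov Literature.Probability.Process.BrownianModulus

variable {Ω : Type*} {mΩ : MeasurableSpace Ω} {P : Measure Ω} {B : ℝ≥0 → Ω → ℝ}

/-- **Lévy's modulus of continuity, upper bound (eventual form, deterministic constant).** For a
Brownian motion `B` and `N : ℕ`: almost surely, for all sufficiently large `n`, all
`s, t ∈ [0, N]` with `|s - t| ≤ 2⁻ⁿ` satisfy `|B s - B t| ≤ 48 √((n + 1) 2⁻ⁿ)`. (A weak form,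
with a non-sharp constant, of Lawler (2005), Cor. 1.38:
`limsup_{δ→0+} osc(B, δ, 1)/√(δ log(1/δ)) ≤ 6` w.p.1; Lévy's theorem gives the constant `√2`.)
(Dot-notation extension of Mathlib's `ProbabilityTheory.IsBrownianReal`.)
[cite: Lawler2005, Cor. 1.38] -/
theorem IsBrownianReal.ae_eventually_dist_le (hB : IsBrownianReal B P) (N : ℕ) :
    ∀ᵐ ω ∂P, ∀ᶠ n : ℕ in atTop, ∀ s t : ℝ≥0, s ≤ N → t ≤ N → dist s t ≤ (2 ^ n)⁻¹ →
      dist (B s ω) (B t ω) ≤ 48 * Real.sqrt ((n + 1) / 2 ^ n) := by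
  filter_upwards [ae_eventually_abs_sub_dyad_lt hB.toIsPreBrownianReal N, hB.cont] with ω hω hcont
  obtain ⟨n₀, hn₀⟩ := eventually_atTop.1 hω
  have hincr : ∀ m, n₀ < m → ∀ k, k + 1 ≤ N * 2 ^ m →
      |B (dyad m k) ω - B (dyad m (k + 1)) ω| ≤ Real.sqrt (2 * m / 2 ^ m) :=
    fun m hm k hk ↦ (hn₀ m hm.le k hk).le
  refine eventually_atTop.2 ⟨n₀ + 1, fun n hn s t hs ht hd ↦ ?_⟩
  obtain ⟨n', rfl⟩ : ∃ n', n = n' + 1 := ⟨n - 1, by omega⟩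
  have hn' : n₀ ≤ n' := by omega
  -- the bound at scale `n'` on the dyadics, for the path `f = B · ω`
  have hdy : ∀ s' ∈ dyadics, ∀ t' ∈ dyadics, s' ≤ N → t' ≤ N → dist s' t' < (2 ^ n')⁻¹ →
      dist (B s' ω) (B t' ω) ≤ 2 * ((1 - (Real.sqrt 2)⁻¹) ^ 2)⁻¹ * Real.sqrt ((n' + 1) / 2 ^ n') :=
    fun s' hs' t' ht' hs'N ht'N hd' ↦
      dist_le_of_increments (f := fun x ↦ B x ω) hn' hincr hs' ht' hs'N ht'N hd'
  -- approximate `s, t` from below by dyadics and pass to the limit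
  set u : ℝ≥0 → ℕ → ℝ≥0 := fun x m ↦ dyad m ⌊(x : ℝ) * 2 ^ m⌋₊ with hu
  have hus : Tendsto (u s) atTop (𝓝 s) := (tendsto_dyad_floor s).mono_right nhdsWithin_le_nhds
  have hut : Tendsto (u t) atTop (𝓝 t) := (tendsto_dyad_floor t).mono_right nhdsWithin_le_nhds
  have hL : Tendsto (fun m ↦ dist (B (u s m) ω) (B (u t m) ω)) atTop
      (𝓝 (dist (B s ω) (B t ω))) :=
    ((hcont.tendsto s).comp hus).dist ((hcont.tendsto t).comp hut)
  have hlt : dist s t < (2 ^ n')⁻¹ := by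
    refine hd.trans_lt ?_
    rw [pow_succ]
    exact inv_strictAnti₀ (by positivity) (lt_mul_of_one_lt_right (by positivity) one_lt_two)
  have hev : ∀ᶠ m in atTop, dist (u s m) (u t m) < (2 ^ n')⁻¹ :=
    ((continuous_dist.tendsto (s, t)).comp (hus.prodMk_nhds hut)).eventually (gt_mem_nhds hlt)
  have hbound : dist (B s ω) (B t ω) ≤ 2 * ((1 - (Real.sqrt 2)⁻¹) ^ 2)⁻¹ * Real.sqrt ((n' + 1) / 2 ^ n') := by
    refine le_of_tendsto hL ?_
    filter_upwards [hev] with m hm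
    exact hdy _ (dyad_mem_dyadics _ _) _ (dyad_mem_dyadics _ _) ((dyad_floor_le s m).trans hs)
      ((dyad_floor_le t m).trans ht) hm
  exact hbound.trans (two_mul_chainConst_mul_sqrt_le n')

/-- **Lévy's modulus of continuity, upper bound (random constant, all scales).** For a Brownian
motion `B` and `N : ℕ`: almost surely there is `C` such that for every `n : ℕ` and all
`s, t ∈ [0, N]` with `|s - t| ≤ 2⁻ⁿ`, `|B s - B t| ≤ C √((n + 1) 2⁻ⁿ)`; equivalently
`C' √(h log(1/h))` is a modulus of continuity of the path on `[0, N]`. (A weak form of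
Lawler (2005), Cor. 1.38 / Lévy (1937).) [cite: Lawler2005, Cor. 1.38] -/
theorem IsBrownianReal.ae_exists_dist_le (hB : IsBrownianReal B P) (N : ℕ) :
    ∀ᵐ ω ∂P, ∃ C : ℝ, ∀ (n : ℕ) (s t : ℝ≥0), s ≤ N → t ≤ N → dist s t ≤ (2 ^ n)⁻¹ →
      dist (B s ω) (B t ω) ≤ C * Real.sqrt ((n + 1) / 2 ^ n) := by
  filter_upwards [hB.ae_eventually_dist_le N, hB.cont] with ω hω hcont
  obtain ⟨n₁, hn₁⟩ := eventually_atTop.1 hω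
  -- a bound for the path on `[0, N]`
  obtain ⟨M, hM⟩ := (isCompact_Icc (a := (0 : ℝ≥0)) (b := N)).exists_bound_of_continuousOn
    hcont.continuousOn
  have hM0 : 0 ≤ M := (norm_nonneg _).trans (hM 0 ⟨le_rfl, by positivity⟩)
  -- the smallest value of the modulus over the scales `n < n₁`
  set q : ℝ := Real.sqrt (1 / 2 ^ n₁) with hq
  have hq0 : 0 < q := Real.sqrt_pos.2 (by positivity)
  refine ⟨max 48 (2 * M / q), fun n s t hs ht hd ↦ ?_⟩
  rcases le_or_gt n₁ n with hn | hn
  · exact (hn₁ n hn s t hs ht hd).trans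
      (mul_le_mul_of_nonneg_right (le_max_left _ _) (Real.sqrt_nonneg _))
  · -- small scales: `|B s - B t| ≤ 2M ≤ (2M/q) q ≤ C √((n+1) 2⁻ⁿ)`
    have hst : dist (B s ω) (B t ω) ≤ 2 * M := by
      calc dist (B s ω) (B t ω) ≤ ‖B s ω‖ + ‖B t ω‖ := dist_le_norm_add_norm _ _
        _ ≤ M + M := add_le_add (hM s ⟨_root_.zero_le, hs⟩) (hM t ⟨_root_.zero_le, ht⟩)
        _ = 2 * M := by ring
    have hqle : q ≤ Real.sqrt ((n + 1) / 2 ^ n) := by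
      refine Real.sqrt_le_sqrt ?_
      calc (1 : ℝ) / 2 ^ n₁ ≤ 1 / 2 ^ n :=
            div_le_div_of_nonneg_left zero_le_one (by positivity)
              (pow_le_pow_right₀ one_le_two hn.le)
        _ ≤ (n + 1) / 2 ^ n :=
            div_le_div_of_nonneg_right (by linarith [(Nat.cast_nonneg n : (0 : ℝ) ≤ n)])
              (by positivity)
    calc dist (B s ω) (B t ω) ≤ 2 * M := hst
      _ = 2 * M / q * q := (div_mul_cancel₀ _ hq0.ne').symm
      _ ≤ max 48 (2 * M / q) * Real.sqrt ((n + 1) / 2 ^ n) :=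
          mul_le_mul (le_max_right _ _) hqle hq0.le (le_max_of_le_left (by norm_num))

/-- **Lévy's modulus of continuity, upper bound, on all bounded intervals simultaneously**: almost
surely, for every `N : ℕ` there is `C` with `|B s - B t| ≤ C √((n + 1) 2⁻ⁿ)` for all `n` and
all `s, t ∈ [0, N]` with `|s - t| ≤ 2⁻ⁿ`. [cite: Lawler2005, Cor. 1.38] -/
theorem IsBrownianReal.ae_forall_exists_dist_le (hB : IsBrownianReal B P) :
    ∀ᵐ ω ∂P, ∀ N : ℕ, ∃ C : ℝ, ∀ (n : ℕ) (s t : ℝ≥0), s ≤ N → t ≤ N → dist s t ≤ (2 ^ n)⁻¹ →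
      dist (B s ω) (B t ω) ≤ C * Real.sqrt ((n + 1) / 2 ^ n) :=
  ae_all_iff.2 fun N ↦ hB.ae_exists_dist_le N

/-- **The form used for the Loewner trace** (Lawler (2005), Lemma 4.33, hypothesis (4.28):
`|U_{t+s} - U_t| ≤ c √j 2^{-j}` for `0 ≤ s ≤ 2^{-2j}`): almost surely, for every `N` there is
`c` such that `|B s - B t| ≤ c √j 2^{-j}` for all `j ≥ 1` and all `s, t ∈ [0, N]` with
`|s - t| ≤ 4^{-j}`. [cite: Lawler2005, Lemma 4.33 (4.28)] -/
theorem IsBrownianReal.ae_forall_exists_abs_sub_le_sqrt (hB : IsBrownianReal B P) :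
    ∀ᵐ ω ∂P, ∀ N : ℕ, ∃ c : ℝ, ∀ (j : ℕ), 1 ≤ j → ∀ (s t : ℝ≥0), s ≤ N → t ≤ N →
      dist s t ≤ (4 ^ j)⁻¹ → |B s ω - B t ω| ≤ c * Real.sqrt j / 2 ^ j := by
  filter_upwards [hB.ae_forall_exists_dist_le] with ω hω N
  obtain ⟨C, hC⟩ := hω N
  refine ⟨2 * max C 0, fun j hj s t hs ht hd ↦ ?_⟩
  have hj' : (1 : ℝ) ≤ j := by exact_mod_cast hj
  have h4 : ((4 : ℝ) ^ j)⁻¹ = ((2 : ℝ) ^ (2 * j))⁻¹ := by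
    rw [pow_mul]
    norm_num
  rw [h4] at hd
  have h := hC (2 * j) s t hs ht hd
  rw [Real.dist_eq] at h
  refine h.trans ?_
  -- `C √((2j+1)/2^(2j)) ≤ 2 max(C,0) √j / 2^j`
  have hsq : Real.sqrt ((((2 * j : ℕ) : ℝ) + 1) / 2 ^ (2 * j)) ≤ 2 * Real.sqrt j / 2 ^ j := by
    have e1 : (2 : ℝ) ^ (2 * j) = (2 ^ j) ^ 2 := by rw [← pow_mul, mul_comm]
    rw [e1, Real.sqrt_div' _ (by positivity), Real.sqrt_sq (by positivity)]
    refine div_le_div_of_nonneg_right ?_ (by positivity)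
    have h4' : Real.sqrt 4 = 2 := by
      rw [show (4 : ℝ) = 2 ^ 2 by norm_num, Real.sqrt_sq zero_le_two]
    have e2 : (2 : ℝ) * Real.sqrt j = Real.sqrt (4 * j) := by
      rw [Real.sqrt_mul (by norm_num), h4']
    rw [e2]
    refine Real.sqrt_le_sqrt ?_
    push_cast
    linarith
  calc C * Real.sqrt ((((2 * j : ℕ) : ℝ) + 1) / 2 ^ (2 * j))
      ≤ max C 0 * Real.sqrt ((((2 * j : ℕ) : ℝ) + 1) / 2 ^ (2 * j)) :=
        mul_le_mul_of_nonneg_right (le_max_left _ _) (Real.sqrt_nonneg _)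
    _ ≤ max C 0 * (2 * Real.sqrt j / 2 ^ j) :=
        mul_le_mul_of_nonneg_left hsq (le_max_right _ _)
    _ = 2 * max C 0 * Real.sqrt j / 2 ^ j := by ring

end ProbabilityTheory
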